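import Mathlib
import HarnessLib

/-!
# The determinant of `λ + Δ` on the discrete circle `ℤ/t`:
# `Π_{q<t} (x − 2cos(2πq/t)) = 2·T_t(x/2) − 2` (characteristic polynomial of the cycle `C_t`),
# `Π_{q<t} (2cosh ω − 2cos(2πq/t)) = 4 sinh²(tω/2)`, `Π_{q<t} (λ + 4 sin²(πq/t)) = 4 sinh²(t·ω_λ/2)`

Topic `Literature/Analysis/SpecialFunctions`.  Everything here is PROVED; no definitions, no named facts.
Requested on the `ym-ir` bus (LEAD `twisted-slab-continuity` g2, 2026-08-28: «the time-circle determinant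
`Π_{q<t}(x − 2cos(2πq/t)) = 2T_t(x/2) − 2`» — the Gaussian (harmonic) partition function of one mode of
frequency `ω_λ`, `λ = 2cosh ω_λ − 2`, on a periodic time lattice of `t` slices: `det(λ + Δ_{ℤ/t}) = 4 sinh²(tω_λ/2)`).

The printed statement: the characteristic polynomial of the circuit `C_t` is `P_{C_t}(x) = 2(T_t(x/2) − 1)`
(Cvetković–Doob–Sachs, *Spectra of Graphs*, §2.6, 6°), the spectrum being `2cos(2πq/t)`, `q = 1, …, t`; i.e.
`Π_{q<t}(x − 2cos(2πq/t)) = 2T_t(x/2) − 2`.  PROOF HERE: with `x = z + z⁻¹` and `ζ = e^{2πi/t}`,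
`z + z⁻¹ − (ζ^q + ζ^{−q}) = (z − ζ^q)(z − ζ^{−q})/z`, and `Π_{q<t}(X − ζ^{±q}) = X^t − 1` (Mathlib
`X_pow_sub_C_eq_prod`), so the product is `(z^t − 1)²/z^t = z^t + z^{−t} − 2`; then `z = e^{ω}` (`x = 2cosh ω`)
and `T_t(cosh ω) = cosh(tω)` (Mathlib `Polynomial.Chebyshev.T_real_cosh`); the polynomial identity for ALL real `x`
follows since both sides are polynomials agreeing on `[2, ∞)`.

* `prod_range_sub_pow_primitiveRoot` : `Π_{q<t} (z − ζ^q) = z^t − 1`;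
* ★ `prod_add_inv_sub_two_cos` : `Π_{q<t} (z + z⁻¹ − 2cos(2πq/t)) = z^t + (z^t)⁻¹ − 2` (`z ≠ 0`, complex);
* ★ `prod_two_cosh_sub_two_cos` : `Π_{q<t} (2cosh ω − 2cos(2πq/t)) = 2cosh(tω) − 2` (real);
* ★★ `prod_add_four_sin_sq` : `Π_{q<t} (4 sinh²(ω/2) + 4 sin²(πq/t)) = 4 sinh²(tω/2)` — the determinant of
  `λ + Δ_{ℤ/t}` with `λ = 4 sinh²(ω/2) = 2cosh ω − 2`;
* `prod_sub_two_cos_eq_chebyshev` : `Π_{q<t} (x − 2cos(2πq/t)) = 2·(T ℝ t).eval (x/2) − 2` for every real `x`.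

HONEST FRAMING: elementary algebra ∕ trigonometry; an arithmetic input for harmonic (tree-level) transfer-matrix
computations on one box (cell `ym-ir`, row 43, item M2); width 0 by itself; the Yang–Mills mass gap (Clay) is NOT
touched; `R4` closes only `BalabanLadder.UV`.

## References
* D. M. Cvetković, M. Doob, H. Sachs, *Spectra of Graphs*, Academic Press (1980), §2.6, 6° (spectrum and
  characteristic polynomial of the circuit `C_n`: `P_{C_n}(λ) = 2(T_n(λ/2) − 1)`; corpus
  `book:cvetkovic1995-spectra-graphs-theory-application` p0065). [CvetkovicDoobSachs1980]
-/

noncomputable section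

open Finset Complex Polynomial

namespace Literature.Analysis.SpecialFunctions

/-- `Π_{q<t} (z − ζ^q) = z^t − 1` for a primitive `t`-th root of unity `ζ` (`t > 0`).
[cite: CvetkovicDoobSachs1980, §2.6, 6° (the spectrum of the circuit = t-th roots of unity doubled)] -/
theorem prod_range_sub_pow_primitiveRoot {t : ℕ} (ht : 0 < t) {ζ : ℂ} (hζ : IsPrimitiveRoot ζ t) (z : ℂ) :
    ∏ q ∈ range t, (z - ζ ^ q) = z ^ t - 1 := by
  have h := X_pow_sub_C_eq_prod hζ ht (one_pow t : (1 : ℂ) ^ t = 1)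
  have h' := congrArg (Polynomial.eval z) h
  simp only [eval_sub, eval_pow, eval_X, eval_C, eval_prod, mul_one] at h'
  exact h'.symm

/-- The standard primitive root `e^{2πi/t}` and `2cos(2πq/t) = ζ^q + ζ^{−q}`. [folklore] -/
private theorem two_cos_eq_pow_add_inv {t : ℕ} (q : ℕ) :
    (2 * Real.cos (2 * Real.pi * q / t) : ℂ) =
      Complex.exp (2 * Real.pi * I / t) ^ q + (Complex.exp (2 * Real.pi * I / t) ^ q)⁻¹ := by
  rw [← Complex.exp_nat_mul, ← Complex.exp_neg, Complex.ofReal_cos, Complex.two_cos]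
  congr 1
  · congr 1
    push_cast
    ring
  · congr 1
    push_cast
    ring

/-- ★ **The circle product, Laurent form**: for `z ≠ 0` and `t ≥ 1`,
`Π_{q<t} (z + z⁻¹ − 2cos(2πq/t)) = z^t + (z^t)⁻¹ − 2` (each factor is `(z − ζ^q)(z − ζ^{−q})/z`, and both
products over the roots of unity are `z^t − 1`). [cite: CvetkovicDoobSachs1980, §2.6, 6° (P_{C_n}(λ) = 2(T_n(λ/2) − 1))] -/
theorem prod_add_inv_sub_two_cos {t : ℕ} (ht : 0 < t) {z : ℂ} (hz : z ≠ 0) :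
    ∏ q ∈ range t, (z + z⁻¹ - (2 * Real.cos (2 * Real.pi * q / t) : ℂ)) = z ^ t + (z ^ t)⁻¹ - 2 := by
  set ζ : ℂ := Complex.exp (2 * Real.pi * I / t) with hζdef
  have hζ : IsPrimitiveRoot ζ t := Complex.isPrimitiveRoot_exp t ht.ne'
  have hζ0 : ζ ≠ 0 := Complex.exp_ne_zero _
  -- each factor
  have hfac : ∀ q : ℕ, z + z⁻¹ - (2 * Real.cos (2 * Real.pi * q / t) : ℂ) =
      (z - ζ ^ q) * (z - (ζ⁻¹) ^ q) * z⁻¹ := by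
    intro q
    rw [two_cos_eq_pow_add_inv q, ← hζdef, inv_pow]
    have hq : ζ ^ q ≠ 0 := pow_ne_zero _ hζ0
    field_simp
    ring
  rw [Finset.prod_congr rfl fun q _ => hfac q, Finset.prod_mul_distrib, Finset.prod_mul_distrib,
    prod_range_sub_pow_primitiveRoot ht hζ, prod_range_sub_pow_primitiveRoot ht hζ.inv, Finset.prod_const,
    Finset.card_range, inv_pow]
  have hzt : z ^ t ≠ 0 := pow_ne_zero _ hz
  field_simp
  ring

/-- ★ **Real form**: `Π_{q<t} (2cosh ω − 2cos(2πq/t)) = 2cosh(tω) − 2` (`z = e^{ω}`).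
[cite: CvetkovicDoobSachs1980, §2.6, 6°] -/
theorem prod_two_cosh_sub_two_cos {t : ℕ} (ht : 0 < t) (ω : ℝ) :
    ∏ q ∈ range t, (2 * Real.cosh ω - 2 * Real.cos (2 * Real.pi * q / t)) = 2 * Real.cosh (t * ω) - 2 := by
  have h := prod_add_inv_sub_two_cos ht (Complex.exp_ne_zero (ω : ℂ))
  have h1 : Complex.exp (ω : ℂ) + (Complex.exp (ω : ℂ))⁻¹ = (2 * Real.cosh ω : ℝ) := by
    rw [Complex.ofReal_mul, Complex.ofReal_ofNat, Complex.ofReal_cosh, Complex.two_cosh, Complex.exp_neg]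
  have h2 : Complex.exp (ω : ℂ) ^ t + (Complex.exp (ω : ℂ) ^ t)⁻¹ = (2 * Real.cosh (t * ω) : ℝ) := by
    rw [Complex.ofReal_mul, Complex.ofReal_ofNat, Complex.ofReal_cosh, Complex.two_cosh, ← Complex.exp_nat_mul,
      ← Complex.exp_neg, Complex.ofReal_mul, Complex.ofReal_natCast]
  rw [h1, h2] at h
  apply Complex.ofReal_injective
  push_cast at h ⊢
  exact h

/-- ★★ **The determinant of `λ + Δ` on the discrete circle `ℤ/t`** (eigenvalues of the circle Laplacian:
`4 sin²(πq/t)`, `q < t`): with `λ = 4 sinh²(ω/2) = 2cosh ω − 2 ≥ 0`,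
`Π_{q<t} (4 sinh²(ω/2) + 4 sin²(πq/t)) = 4 sinh²(tω/2)` — the harmonic-mode partition function on `t` periodic
time slices. [cite: CvetkovicDoobSachs1980, §2.6, 6° (P_{C_t}(x) = 2T_t(x/2) − 2 at x = 2cosh ω)] -/
theorem prod_add_four_sin_sq {t : ℕ} (ht : 0 < t) (ω : ℝ) :
    ∏ q ∈ range t, (4 * Real.sinh (ω / 2) ^ 2 + 4 * Real.sin (Real.pi * q / t) ^ 2) =
      4 * Real.sinh (t * ω / 2) ^ 2 := by
  have h := prod_two_cosh_sub_two_cos ht ω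
  have hfac : ∀ q : ℕ, 2 * Real.cosh ω - 2 * Real.cos (2 * Real.pi * q / t) =
      4 * Real.sinh (ω / 2) ^ 2 + 4 * Real.sin (Real.pi * q / t) ^ 2 := by
    intro q
    have hc : Real.cosh ω = Real.cosh (2 * (ω / 2)) := by ring_nf
    have hs : Real.cos (2 * Real.pi * q / t) = Real.cos (2 * (Real.pi * q / t)) := by ring_nf
    rw [hc, hs, Real.cosh_two_mul, Real.cos_two_mul, Real.cosh_sq, Real.sin_sq]
    ring
  have hrhs : 2 * Real.cosh (t * ω) - 2 = 4 * Real.sinh (t * ω / 2) ^ 2 := by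
    have hc : Real.cosh (t * ω) = Real.cosh (2 * (t * ω / 2)) := by ring_nf
    rw [hc, Real.cosh_two_mul, Real.cosh_sq]
    ring
  rw [← hrhs, ← h]
  exact Finset.prod_congr rfl fun q _ => (hfac q).symm

/-- The same with the frequency determined by `λ ≥ 0`: `ω_λ = 2 arsinh(√λ/2)` satisfies `4 sinh²(ω_λ/2) = λ`
and `cosh ω_λ = 1 + λ/2`, and `Π_{q<t} (λ + 4 sin²(πq/t)) = 4 sinh²(t ω_λ/2)`.
[cite: CvetkovicDoobSachs1980, §2.6, 6°] -/
theorem prod_add_four_sin_sq_of_nonneg {t : ℕ} (ht : 0 < t) {lam : ℝ} (hlam : 0 ≤ lam) :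
    ∏ q ∈ range t, (lam + 4 * Real.sin (Real.pi * q / t) ^ 2) =
      4 * Real.sinh (t * (2 * Real.arsinh (Real.sqrt lam / 2)) / 2) ^ 2 := by
  have hω : 4 * Real.sinh (2 * Real.arsinh (Real.sqrt lam / 2) / 2) ^ 2 = lam := by
    rw [mul_div_cancel_left₀ _ (two_ne_zero), Real.sinh_arsinh, div_pow, Real.sq_sqrt hlam]
    ring
  rw [← prod_add_four_sin_sq ht, hω]

/-- `cosh ω_λ = 1 + λ/2` for `ω_λ = 2 arsinh(√λ/2)`, `λ ≥ 0`. [cite: CvetkovicDoobSachs1980, §2.6, 6°] -/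
theorem cosh_two_arsinh_sqrt_div_two {lam : ℝ} (hlam : 0 ≤ lam) :
    Real.cosh (2 * Real.arsinh (Real.sqrt lam / 2)) = 1 + lam / 2 := by
  rw [Real.cosh_two_mul, Real.cosh_sq, Real.sinh_arsinh, div_pow, Real.sq_sqrt hlam]
  ring

/-- **Characteristic polynomial of the cycle** (Cvetković–Doob–Sachs §2.6, 6°): for every real `x` and `t ≥ 1`,
`Π_{q<t} (x − 2cos(2πq/t)) = 2·T_t(x/2) − 2`, `T_t` the Chebyshev polynomial of the first kind (both sides are
polynomials in `x` agreeing on `x = 2cosh ω`, `ω ∈ ℝ`). [cite: CvetkovicDoobSachs1980, §2.6, 6°] -/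
theorem prod_sub_two_cos_eq_chebyshev {t : ℕ} (ht : 0 < t) (x : ℝ) :
    ∏ q ∈ range t, (x - 2 * Real.cos (2 * Real.pi * q / t)) =
      2 * (Polynomial.Chebyshev.T ℝ t).eval (x / 2) - 2 := by
  -- both sides as polynomials
  set P : ℝ[X] := ∏ q ∈ range t, (X - C (2 * Real.cos (2 * Real.pi * q / t))) with hP
  set Q : ℝ[X] := 2 * (Polynomial.Chebyshev.T ℝ t).comp (C (1 / 2 : ℝ) * X) - 2 with hQ
  have hPe : ∀ y : ℝ, P.eval y = ∏ q ∈ range t, (y - 2 * Real.cos (2 * Real.pi * q / t)) := fun y => by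
    simp only [hP, eval_prod, eval_sub, eval_X, eval_C]
  have hQe : ∀ y : ℝ, Q.eval y = 2 * (Polynomial.Chebyshev.T ℝ t).eval (y / 2) - 2 := fun y => by
    simp only [hQ, eval_sub, eval_mul, eval_comp, eval_C, eval_X, eval_ofNat]
    ring_nf
  -- they agree on `[2, ∞)` (x = 2 cosh ω)
  have hagree : ∀ y : ℝ, 2 ≤ y → P.eval y = Q.eval y := by
    intro y hy
    obtain ⟨ω, hω⟩ : ∃ ω : ℝ, 2 * Real.cosh ω = y := by
      refine ⟨Real.arcosh (y / 2), ?_⟩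
      rw [Real.cosh_arcosh (by linarith)]
      ring
    rw [hPe, hQe, ← hω, prod_two_cosh_sub_two_cos ht ω]
    congr 1
    rw [mul_div_cancel_left₀ _ (two_ne_zero), Polynomial.Chebyshev.T_real_cosh]
    push_cast
    ring_nf
  have hPQ : P = Q := by
    apply Polynomial.eq_of_infinite_eval_eq
    refine Set.Infinite.mono (s := (fun y : ℝ => y) '' Set.Ici 2) ?_ ((Set.Ici_infinite 2).image
      (Function.injective_id.injOn))
    rintro _ ⟨y, hy, rfl⟩
    exact hagree y hy
  have := congrArg (Polynomial.eval x) hPQ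
  rwa [hPe, hQe] at this

end Literature.Analysis.SpecialFunctions
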